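import Mathlib
import HarnessLib
import Literature.Geometry.Lorentzian.KerrSchild
import Literature.Geometry.Lorentzian.KerrWaveDecay
import Literature.Geometry.Lorentzian.KerrConvergence
import Literature.Geometry.Lorentzian.KerrConvergenceProofs
import Literature.Geometry.Lorentzian.BoostedKerrSchildDecay
import Literature.Geometry.Lorentzian.MultiCentreKerrSchild
import Literature.Geometry.Lorentzian.KerrSchildChartCovariance
import Literature.Geometry.Lorentzian.KerrSchildHomogeneity

/-!
# Boosted Kerr–Schild family: continuity of the `y`-jets in `(M, a)`, uniform far-field decay

Stub `stub_kerrSchildJets` of the line `registered` for the crux `DyadicCapture`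
(`Summit.FinalStateConjecture.FinalStateConjecture.Theses.LogTimeThreeAnnuli.DyadicCapture`).
Two facts about the boosted, translated Kerr–Schild family
`boostedKerrBilin Λ c M a x = g_{M,a}(Λ⁻¹(x − c))(Λ⁻¹ ·, Λ⁻¹ ·)` (Kerr–Schild 1965, §2):

* **jet continuity in the parameters**: off the disc of `p₀ = (M₀, a₀)` (i.e. where the rest-frame
  Kerr–Schild radius `r_{a₀}(Λ⁻¹(x − c))` is positive) the `y`-jets
  `p ↦ Dᵐ_y (boostedKerrBilin Λ c p.1 p.2)(x)` are continuous at `p₀`. Proof: the family is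
  JOINTLY smooth in `((M, a), y)` on the open set `{r_a(Λ⁻¹(y − c)) > 0}` (joint smoothness in
  `(a, y)`, `contDiffAt_boostedKerrBilin₂`, and linearity in `M` of the Kerr–Schild term
  `2H ℓ ⊗ ℓ`, `H = M r³/(r⁴ + a²z²)`), and the `y`-jet of a jointly smooth map is the joint jet
  composed with the isometric embedding `inr` (Dieudonné 1960, (8.12.8);
  `ContinuousLinearMap.iteratedFDerivWithin_comp_right`), which is continuous in the base point;
* **uniform far-field decay on a compact parameter window**:
  `‖Dᵐ(boostedKerrBilin Λ c M a − η)(x)‖ ≤ C / r_a(Λ⁻¹(x − c))` for `r_a ≥ R₀`, with `C, R₀`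
  depending only on `Λ, m` and the window `m₀ ≤ M ≤ 1/m₀`, `|a| ≤ χ M`. This is the scaling proof
  of `norm_iteratedFDeriv_boostedKsPert_le` (`BoostedKerrSchildDecay.lean`) with its constants
  made explicit: `C = |M| · max B 0 ≤ m₀⁻¹ max B 0`, `R = max 1 (2|a|) ≤ max 1 (2|χ|/m₀)`, where
  `B = B(Λ, m)` is the uniform bound on the boosted unit shell
  (`exists_bound_iteratedFDeriv_boostedKsPert_one`).

## References

* R. P. Kerr, A. Schild, *A new class of vacuum solutions of the Einstein field equations* (1965),
  §2–§3 (key `KerrSchild1965`).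
* J. Dieudonné, *Foundations of Modern Analysis* (1960), (8.12.8).
-/

-- the `Summit.FinalStateConjecture.FinalStateConjecture.…` namespace repeats the summit = sub-problem segment (D-0017); deliberate.
set_option linter.dupNamespace false

noncomputable section
namespace Summit.FinalStateConjecture.FinalStateConjecture.Theorems
open Literature.Geometry.Lorentzian
open scoped Topology Manifold ENNReal ContDiff
open Filter Set

/-! ### Jets of slices of jointly smooth maps -/

/-- **The slice jet of a `C^n` map on an open set of `P × F`**: for `g` `C^n` on the open set
`O ∋ (θ₀, ξ₀)` and `i ≤ n`, `Dⁱ (g(θ₀, ·))(ξ₀) = Dⁱ g(θ₀, ξ₀) ∘ (inr, …, inr)` (the slice is the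
composition with the affine embedding `ξ ↦ (θ₀, ξ)`; Dieudonné 1960, (8.12.8)). [folklore] -/
theorem dyadicCapture_iteratedFDeriv_slice_eq {P F G : Type*} [NormedAddCommGroup P]
    [NormedSpace ℝ P] [NormedAddCommGroup F] [NormedSpace ℝ F] [NormedAddCommGroup G]
    [NormedSpace ℝ G] {g : P × F → G} {O : Set (P × F)} (hO : IsOpen O) {n : WithTop ℕ∞}
    (hg : ContDiffOn ℝ n g O) {θ₀ : P} {ξ₀ : F} (hp : (θ₀, ξ₀) ∈ O) {i : ℕ}
    (hi : (i : WithTop ℕ∞) ≤ n) :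
    iteratedFDeriv ℝ i (fun ξ ↦ g (θ₀, ξ)) ξ₀ =
      (iteratedFDeriv ℝ i g (θ₀, ξ₀)).compContinuousLinearMap
        fun _ ↦ ContinuousLinearMap.inr ℝ P F := by
  -- adapted from `Kerr.norm_iteratedFDeriv_slice_le` (KerrConvergenceProofs.lean)
  set U₀ : Set (P × F) := (fun q : P × F ↦ ((θ₀, (0 : F)) : P × F) + q) ⁻¹' O with hU₀
  have hU₀o : IsOpen U₀ := hO.preimage (by fun_prop)
  set h : P × F → G := fun q ↦ g (((θ₀, (0 : F)) : P × F) + q) with hh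
  have hhs : ContDiffOn ℝ n h U₀ := hg.comp (contDiffOn_const.add contDiffOn_id) fun q hq ↦ hq
  set V : Set F := (ContinuousLinearMap.inr ℝ P F) ⁻¹' U₀ with hV
  have hVo : IsOpen V := hU₀o.preimage (ContinuousLinearMap.inr ℝ P F).continuous
  have hmem : ContinuousLinearMap.inr ℝ P F ξ₀ ∈ U₀ := by
    simp [hU₀, hp]
  have hξV : ξ₀ ∈ V := hmem
  have key := (ContinuousLinearMap.inr ℝ P F).iteratedFDerivWithin_comp_right hhs hU₀o.uniqueDiffOn
    hVo.uniqueDiffOn hmem hi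
  rw [iteratedFDerivWithin_of_isOpen i hVo hξV, iteratedFDerivWithin_of_isOpen i hU₀o hmem] at key
  have hfun : (h ∘ ContinuousLinearMap.inr ℝ P F) = fun ξ ↦ g (θ₀, ξ) := by
    funext ξ
    simp [hh]
  rw [hfun] at key
  have hpt : iteratedFDeriv ℝ i h (ContinuousLinearMap.inr ℝ P F ξ₀) =
      iteratedFDeriv ℝ i g (θ₀, ξ₀) := by
    rw [hh, iteratedFDeriv_comp_add_left]
    simp
  rw [key, hpt]

/-- **Slice jets of a jointly smooth map are continuous in the parameter**: for `g` `C^∞` on the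
open set `O ∋ (θ₀, ξ₀)` of `P × F`, `θ ↦ Dⁱ (g(θ, ·))(ξ₀)` is continuous at `θ₀` (the slice jet is
the joint jet, continuous on `O`, composed with the fixed embedding `inr`; Dieudonné 1960,
(8.12.8)). [folklore] -/
theorem dyadicCapture_continuousAt_iteratedFDeriv_slice {P F G : Type*} [NormedAddCommGroup P]
    [NormedSpace ℝ P] [NormedAddCommGroup F] [NormedSpace ℝ F] [NormedAddCommGroup G]
    [NormedSpace ℝ G] {g : P × F → G} {O : Set (P × F)} (hO : IsOpen O)
    (hg : ContDiffOn ℝ ∞ g O) {θ₀ : P} {ξ₀ : F} (hp : (θ₀, ξ₀) ∈ O) (i : ℕ) :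
    ContinuousAt (fun θ ↦ iteratedFDeriv ℝ i (fun ξ ↦ g (θ, ξ)) ξ₀) θ₀ := by
  have hcont : ContinuousOn (iteratedFDeriv ℝ i g) O :=
    ContinuousOn.continuousOn_iteratedFDeriv hg hO (by exact_mod_cast le_top)
  have h1 : ContinuousAt (iteratedFDeriv ℝ i g) (θ₀, ξ₀) := hcont.continuousAt (hO.mem_nhds hp)
  have hemb : Continuous fun θ : P ↦ ((θ, ξ₀) : P × F) := by fun_prop
  have h2 : ContinuousAt (fun θ : P ↦ iteratedFDeriv ℝ i g (θ, ξ₀)) θ₀ :=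
    ContinuousAt.comp (f := fun θ : P ↦ ((θ, ξ₀) : P × F)) h1 hemb.continuousAt
  have h3 : ContinuousAt (fun θ : P ↦ (iteratedFDeriv ℝ i g (θ, ξ₀)).compContinuousLinearMap
      fun _ ↦ ContinuousLinearMap.inr ℝ P F) θ₀ :=
    (ContinuousMultilinearMap.continuous_precomp _).continuousAt.comp h2
  have hnhds : ∀ᶠ θ in 𝓝 θ₀, ((θ, ξ₀) : P × F) ∈ O :=
    hemb.continuousAt.preimage_mem_nhds (hO.mem_nhds hp)
  refine h3.congr (hnhds.mono fun θ hθ ↦ ?_)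
  exact (dyadicCapture_iteratedFDeriv_slice_eq hO hg hθ (i := i) (by exact_mod_cast le_top)).symm

/-! ### The boosted Kerr–Schild family: joint smoothness in `((M, a), y)` -/

/-- **Joint smoothness of the boosted Kerr–Schild family in `((M, a), y)`** wherever the rest-frame
radius is positive: `g_{M,a} = η + (2 M H_{1,a} ℓ_a) ⊗ ℓ_a` (`Kerr.scalarH_eq_mul_scalarH_one`)
with `H_{1,a}`, `ℓ_a` jointly smooth in `(a, z)` off `{r = 0}` (`Kerr.contDiffAt_scalarH₂`,
`Kerr.contDiffAt_nullCovector₂`), composed with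
the affine map `((M, a), y) ↦ (a, Λ⁻¹(y − c))` and pre/post-composed with the constant `Λ⁻¹`
(Kerr–Schild 1965, §3). [cite: KerrSchild1965, §3] -/
theorem dyadicCapture_contDiffAt_boostedKerrBilin₃ (Λ : lorentzGroup) (c : E4)
    {q : (ℝ × ℝ) × E4} (hq : 0 < Kerr.radius q.1.2 (poincareInv Λ c q.2)) {n : WithTop ℕ∞} :
    ContDiffAt ℝ n (fun q : (ℝ × ℝ) × E4 ↦ boostedKerrBilin Λ c q.1.1 q.1.2 q.2) q := by
  -- adapted from `contDiffAt_boostedKerrBilin₂` (BoostedKerrSchildDecay.lean)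
  have hπ' : ContDiff ℝ n (fun q : (ℝ × ℝ) × E4 ↦ ((q.1.2, poincareInv Λ c q.2) : ℝ × E4)) :=
    contDiff_fst.snd.prodMk ((contDiff_poincareInv Λ c).comp contDiff_snd)
  have hπ : ContDiffAt ℝ n (fun q : (ℝ × ℝ) × E4 ↦ ((q.1.2, poincareInv Λ c q.2) : ℝ × E4)) q :=
    hπ'.contDiffAt
  have hH₂ : ContDiffAt ℝ n (fun p : ℝ × E4 ↦ Kerr.scalarH 1 p.1 p.2)
      (q.1.2, poincareInv Λ c q.2) :=
    Kerr.contDiffAt_scalarH₂ 1 (p := (q.1.2, poincareInv Λ c q.2)) hq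
  have hH : ContDiffAt ℝ n
      (fun q : (ℝ × ℝ) × E4 ↦ Kerr.scalarH 1 q.1.2 (poincareInv Λ c q.2)) q :=
    ContDiffAt.comp (g := fun p : ℝ × E4 ↦ Kerr.scalarH 1 p.1 p.2)
      (f := fun q : (ℝ × ℝ) × E4 ↦ ((q.1.2, poincareInv Λ c q.2) : ℝ × E4)) q hH₂ hπ
  have hl₂ : ContDiffAt ℝ n (fun p : ℝ × E4 ↦ Kerr.nullCovector p.1 p.2)
      (q.1.2, poincareInv Λ c q.2) :=
    Kerr.contDiffAt_nullCovector₂ (p := (q.1.2, poincareInv Λ c q.2)) hq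
  have hl : ContDiffAt ℝ n
      (fun q : (ℝ × ℝ) × E4 ↦ Kerr.nullCovector q.1.2 (poincareInv Λ c q.2)) q :=
    ContDiffAt.comp (g := fun p : ℝ × E4 ↦ Kerr.nullCovector p.1 p.2)
      (f := fun q : (ℝ × ℝ) × E4 ↦ ((q.1.2, poincareInv Λ c q.2) : ℝ × E4)) q hl₂ hπ
  have hM : ContDiffAt ℝ n (fun q : (ℝ × ℝ) × E4 ↦ q.1.1) q := contDiff_fst.fst.contDiffAt
  have hpert : ContDiffAt ℝ n (fun q : (ℝ × ℝ) × E4 ↦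
      E4.tmul ((2 * (q.1.1 * Kerr.scalarH 1 q.1.2 (poincareInv Λ c q.2))) •
        Kerr.nullCovector q.1.2 (poincareInv Λ c q.2))
        (Kerr.nullCovector q.1.2 (poincareInv Λ c q.2))) q :=
    ((contDiffAt_const.mul (hM.mul hH)).smul hl).smulRight hl
  have hKb : ContDiffAt ℝ n
      (fun q : (ℝ × ℝ) × E4 ↦ Kerr.bilin q.1.1 q.1.2 (poincareInv Λ c q.2)) q := by
    refine ((contDiffAt_const (c := Minkowski.bilin)).add hpert).congr_of_eventuallyEq
      (Eventually.of_forall fun q ↦ ?_)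
    show Kerr.bilin q.1.1 q.1.2 (poincareInv Λ c q.2) = Minkowski.bilin + _
    rw [Kerr.bilin, Kerr.tmul_smul_left,
      Kerr.scalarH_eq_mul_scalarH_one q.1.1 q.1.2 (poincareInv Λ c q.2)]
  exact contDiffAt_const.clm_comp (hKb.clm_comp contDiffAt_const)

/-- **Continuity of the `y`-jets of the boosted Kerr–Schild family in the parameters `(M, a)`**
off the disc of `p₀ = (M₀, a₀)`: `p ↦ Dᵐ_y (boostedKerrBilin Λ c p.1 p.2)(x)` is continuous at `p₀`
whenever `r_{a₀}(Λ⁻¹(x − c)) > 0` (slice jets of the jointly smooth family on the open set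
`{r > 0}`). [cite: KerrSchild1965, §3] -/
theorem dyadicCapture_continuousAt_jets_boostedKerrBilin (Λ : lorentzGroup) (c x : E4)
    (p₀ : ℝ × ℝ) (m : ℕ) (hx : 0 < Kerr.radius p₀.2 (poincareInv Λ c x)) :
    ContinuousAt (fun p : ℝ × ℝ ↦ iteratedFDeriv ℝ m (boostedKerrBilin Λ c p.1 p.2) x) p₀ := by
  set O : Set ((ℝ × ℝ) × E4) := {q | 0 < Kerr.radius q.1.2 (poincareInv Λ c q.2)} with hO
  have hOo : IsOpen O := by
    refine isOpen_lt continuous_const ?_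
    unfold Kerr.radius E4.spatialNorm poincareInv
    fun_prop
  have hcd : ContDiffOn ℝ ∞ (fun q : (ℝ × ℝ) × E4 ↦ boostedKerrBilin Λ c q.1.1 q.1.2 q.2) O :=
    fun q hq ↦ (dyadicCapture_contDiffAt_boostedKerrBilin₃ Λ c hq).contDiffWithinAt
  have hp : (p₀, x) ∈ O := hx
  exact dyadicCapture_continuousAt_iteratedFDeriv_slice hOo hcd hp m

/-! ### Uniform far-field decay on a parameter window -/

/-- **Decay of all derivatives of the boosted Kerr–Schild perturbation, with explicit constants**:
with the boosted unit-shell bound `B = B(Λ, m) ≥ 0`,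
`‖Dᵐ(boostedKerrBilin Λ c M a − η)(x)‖ ≤ |M| B / r_a(Λ⁻¹(x − c))` whenever `r_a(Λ⁻¹(x − c)) ≥ 1` and
`r_a(Λ⁻¹(x − c)) ≥ 2|a|`, for ALL `c, M, a`. This is the scaling proof of
`norm_iteratedFDeriv_boostedKsPert_le` verbatim, with its constants `C = |M| max B 0`,
`R = max 1 (2|a|)` exposed (Kerr–Schild 1965, §2–§3). [cite: KerrSchild1965, §3] -/
theorem dyadicCapture_norm_iteratedFDeriv_boostedKsPert_le_explicit (Λ : lorentzGroup) (m : ℕ) :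
    ∃ B : ℝ, 0 ≤ B ∧ ∀ (c : E4) (M a : ℝ) (x : E4), 1 ≤ Kerr.radius a (poincareInv Λ c x) →
      2 * |a| ≤ Kerr.radius a (poincareInv Λ c x) →
      ‖iteratedFDeriv ℝ m (fun y ↦ boostedKerrBilin Λ c M a y - Minkowski.bilin) x‖ ≤
        |M| * B / Kerr.radius a (poincareInv Λ c x) := by
  -- adapted from `norm_iteratedFDeriv_boostedKsPert_le` (BoostedKerrSchildDecay.lean)
  obtain ⟨B, hB⟩ := exists_bound_iteratedFDeriv_boostedKsPert_one Λ m
  refine ⟨max B 0, le_max_right _ _, fun c M a x hr1 hra ↦ ?_⟩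
  set z : E4 := poincareInv Λ c x with hz
  set s := E4.spatialNorm z with hs
  have hr0 : 0 < Kerr.radius a z := one_pos.trans_le hr1
  have hrs : Kerr.radius a z ≤ s := Kerr.radius_le_spatialNorm a z
  have hs1 : 1 ≤ s := hr1.trans hrs
  have hs0 : 0 < s := one_pos.trans_le hs1
  have hsa : 2 * |a| ≤ s := hra.trans hrs
  set ε := s⁻¹ with hε
  have hε0 : 0 < ε := inv_pos.mpr hs0
  have hε1 : ε ≤ 1 := inv_le_one_of_one_le₀ hs1
  -- kill the rest-frame time coordinate by a translation along `Λe₀`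
  set x' : E4 := x + (-(z 0)) • (Λ : E4 ≃L[ℝ] E4) (E4.basisVector 0) with hx'
  have hz' : poincareInv Λ c x' = z - z 0 • E4.basisVector 0 := by
    rw [hx', poincareInv, add_sub_right_comm, map_add, map_smul,
      ContinuousLinearEquiv.symm_apply_apply, neg_smul, ← sub_eq_add_neg]
    rfl
  have hder := iteratedFDeriv_boostedKsPert_add_smul Λ c M a m x (-(z 0))
  have hsp : E4.spatial (poincareInv Λ c x') = E4.spatial z := by
    have h0 : E4.spatial (E4.basisVector 0) = 0 := by
      ext i
      simp [E4.spatial_apply, Fin.succ_ne_zero]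
    rw [hz', map_sub, map_smul, h0, smul_zero, sub_zero]
  have hz'0 : poincareInv Λ c x' 0 = 0 := by
    rw [hz']
    simp
  have hrx' : Kerr.radius a (poincareInv Λ c x') = Kerr.radius a z :=
    Kerr.radius_eq_of_spatial_eq a hsp
  have hsx' : E4.spatialNorm (poincareInv Λ c x') = s := by
    rw [hs, E4.spatialNorm, E4.spatialNorm, hsp]
  -- the rescaled rest-frame point on the unit shell
  set y₁ : E4 := ε • (x' - c) with hy₁
  have hPy₁ : poincareInv Λ 0 y₁ = ε • poincareInv Λ c x' := by
    rw [hy₁, poincareInv_zero, map_smul]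
    rfl
  have hy₁0 : poincareInv Λ 0 y₁ 0 = 0 := by
    rw [hPy₁]
    simp [hz'0]
  have hy₁1 : E4.spatialNorm (poincareInv Λ 0 y₁) = 1 := by
    rw [hPy₁, Kerr.spatialNorm_smul, abs_of_pos hε0, hsx', hε, inv_mul_cancel₀ hs0.ne']
  have ha' : |ε * a| ≤ 1 / 2 := by
    rw [abs_mul, abs_of_pos hε0, hε]
    rw [inv_mul_le_iff₀ hs0]
    linarith
  -- smoothness of the rescaled boosted perturbation at `ε x'`
  have hrad₁ : 0 < Kerr.radius (ε * a) (poincareInv Λ 0 (ε • x' - ε • c)) := by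
    rw [← smul_sub, ← hy₁, hPy₁, Kerr.radius_smul hε0, hrx']
    exact mul_pos hε0 hr0
  have hG : ContDiffAt ℝ m
      (fun w ↦ boostedKerrBilin Λ 0 1 (ε * a) (w - ε • c) - Minkowski.bilin) (ε • x') := by
    have h1 : ContDiffAt ℝ m (fun w ↦ boostedKerrBilin Λ 0 1 (ε * a) w - Minkowski.bilin)
        (ε • x' - ε • c) := contDiffAt_boostedKsPert hrad₁
    exact h1.comp (ε • x') (contDiffAt_id.sub contDiffAt_const)
  -- scaling of the iterated derivative
  have hfun : (fun y ↦ boostedKerrBilin Λ c M a y - Minkowski.bilin) =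
      fun y ↦ (ε * M) • (fun w ↦ boostedKerrBilin Λ 0 1 (ε * a) (w - ε • c) - Minkowski.bilin)
        (ε • y) := by
    funext y
    rw [boostedKsPert_smul Λ hε0 c M a y, smul_sub]
  have hkey := norm_iteratedFDeriv_const_smul_comp_smul_le
    (fun w ↦ boostedKerrBilin Λ 0 1 (ε * a) (w - ε • c) - Minkowski.bilin) (ε * M) hε0.ne' x'
    (m := m) hG
  have htrans : iteratedFDeriv ℝ m
      (fun w ↦ boostedKerrBilin Λ 0 1 (ε * a) (w - ε • c) - Minkowski.bilin) (ε • x') =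
      iteratedFDeriv ℝ m (fun y ↦ boostedKerrBilin Λ 0 1 (ε * a) y - Minkowski.bilin) y₁ := by
    rw [iteratedFDeriv_comp_sub (f := fun y ↦ boostedKerrBilin Λ 0 1 (ε * a) y - Minkowski.bilin)
      m (ε • c) (ε • x'), hy₁, smul_sub]
  have hεm : |ε| ^ m ≤ 1 := pow_le_one₀ (abs_nonneg ε) (by rwa [abs_of_pos hε0])
  have hB0 : 0 ≤ max B 0 := le_max_right _ _
  calc (‖iteratedFDeriv ℝ m (fun y ↦ boostedKerrBilin Λ c M a y - Minkowski.bilin) x‖ : ℝ)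
      = ‖iteratedFDeriv ℝ m (fun y ↦ boostedKerrBilin Λ c M a y - Minkowski.bilin) x'‖ := by
        rw [hder]
    _ = ‖iteratedFDeriv ℝ m (fun y ↦ (ε * M) •
          (fun w ↦ boostedKerrBilin Λ 0 1 (ε * a) (w - ε • c) - Minkowski.bilin) (ε • y)) x'‖ := by
        rw [← hfun]
    _ ≤ |ε * M| * |ε| ^ m * ‖iteratedFDeriv ℝ m
          (fun w ↦ boostedKerrBilin Λ 0 1 (ε * a) (w - ε • c) - Minkowski.bilin) (ε • x')‖ := hkey
    _ ≤ |ε * M| * 1 * max B 0 := by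
        rw [htrans]
        gcongr
        exact (hB _ ha' y₁ hy₁0 hy₁1).trans (le_max_left _ _)
    _ = ε * (|M| * max B 0) := by
        rw [abs_mul, abs_of_pos hε0]
        ring
    _ ≤ (Kerr.radius a z)⁻¹ * (|M| * max B 0) :=
        mul_le_mul_of_nonneg_right (inv_anti₀ hr0 hrs) (by positivity)
    _ = |M| * max B 0 / Kerr.radius a z := by rw [div_eq_inv_mul]

/-- **Uniform far-field decay on the parameter window** `m₀ ≤ M ≤ m₀⁻¹`, `|a| ≤ χ M`:
`‖Dᵐ(boostedKerrBilin Λ c M a − η)(x)‖ ≤ C / r_a(Λ⁻¹(x − c))` for `r_a(Λ⁻¹(x − c)) ≥ R₀`, with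
`C = m₀⁻¹ B(Λ, m)` and `R₀ = max 1 (2|χ|/m₀)` independent of `(M, a)` and of `c`
(Kerr–Schild 1965, §3: asymptotic flatness of the ansatz, by scaling). [cite: KerrSchild1965, §3] -/
theorem dyadicCapture_norm_iteratedFDeriv_boostedKsPert_le_window (Λ : lorentzGroup) (c : E4)
    (m : ℕ) (m₀ χ : ℝ) (hm₀ : 0 < m₀) :
    ∃ C R₀ : ℝ, 0 < R₀ ∧ ∀ (M a : ℝ), m₀ ≤ M → M ≤ m₀⁻¹ → |a| ≤ χ * M → ∀ x : E4,
      R₀ ≤ Kerr.radius a (poincareInv Λ c x) →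
      ‖iteratedFDeriv ℝ m (fun y ↦ boostedKerrBilin Λ c M a y - Minkowski.bilin) x‖ ≤
        C / Kerr.radius a (poincareInv Λ c x) := by
  obtain ⟨B, hB0, hB⟩ := dyadicCapture_norm_iteratedFDeriv_boostedKsPert_le_explicit Λ m
  refine ⟨m₀⁻¹ * B, max 1 (2 * (|χ| * m₀⁻¹)), lt_max_of_lt_left one_pos,
    fun M a hM1 hM2 ha x hx ↦ ?_⟩
  have hM0 : 0 < M := hm₀.trans_le hM1
  have hr1 : 1 ≤ Kerr.radius a (poincareInv Λ c x) := (le_max_left _ _).trans hx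
  have haχ : |a| ≤ |χ| * m₀⁻¹ :=
    calc |a| ≤ χ * M := ha
      _ ≤ |χ| * M := mul_le_mul_of_nonneg_right (le_abs_self χ) hM0.le
      _ ≤ |χ| * m₀⁻¹ := mul_le_mul_of_nonneg_left hM2 (abs_nonneg χ)
  have hra : 2 * |a| ≤ Kerr.radius a (poincareInv Λ c x) :=
    calc 2 * |a| ≤ 2 * (|χ| * m₀⁻¹) := by linarith
      _ ≤ max 1 (2 * (|χ| * m₀⁻¹)) := le_max_right _ _
      _ ≤ _ := hx
  have hMB : |M| * B ≤ m₀⁻¹ * B := by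
    rw [abs_of_pos hM0]
    exact mul_le_mul_of_nonneg_right hM2 hB0
  exact (hB c M a x hr1 hra).trans
    (div_le_div_of_nonneg_right hMB (Kerr.radius_nonneg a (poincareInv Λ c x)))

/-! ### The stub -/

/-- **Stub `kerrSchildJets` of the line `registered` (crux `DyadicCapture`)** — Kerr–Schild family:
(i) continuity in the parameters `p = (M, a)` of the `y`-jets
`Dᵐ_y (boostedKerrBilin Λ c p.1 p.2)(x)` off the disc of `p₀`
(`dyadicCapture_continuousAt_jets_boostedKerrBilin`); (ii) far-field decay
`‖Dᵐ(g_{M,a,Λ,c} − η)(x)‖ ≤ C / r_a(Λ⁻¹(x − c))` for `r_a ≥ R₀`, UNIFORMLY on the window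
`m₀ ≤ M ≤ 1/m₀`, `|a| ≤ χ M` (`dyadicCapture_norm_iteratedFDeriv_boostedKsPert_le_window`).
Kerr–Schild 1965, §2–§3. [cite: KerrSchild1965, §3] -/
theorem stub_kerrSchildJets : (∀ (Λ : lorentzGroup) (c x : E4) (p₀ : ℝ × ℝ) (m : ℕ), 0 < Kerr.radius p₀.2 (poincareInv Λ c x) → ContinuousAt (fun p : ℝ × ℝ => iteratedFDeriv ℝ m (boostedKerrBilin Λ c p.1 p.2) x) p₀) ∧ (∀ (Λ : lorentzGroup) (c : E4) (m : ℕ) (m₀ χ : ℝ), 0 < m₀ → ∃ C R₀ : ℝ, 0 < R₀ ∧ ∀ (M a : ℝ), m₀ ≤ M → M ≤ m₀⁻¹ → |a| ≤ χ * M → ∀ x : E4, R₀ ≤ Kerr.radius a (poincareInv Λ c x) → ‖iteratedFDeriv ℝ m (fun y => boostedKerrBilin Λ c M a y - Minkowski.bilin) x‖ ≤ C / Kerr.radius a (poincareInv Λ c x)) :=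
  ⟨fun Λ c x p₀ m hx ↦ dyadicCapture_continuousAt_jets_boostedKerrBilin Λ c x p₀ m hx,
    fun Λ c m m₀ χ hm₀ ↦ dyadicCapture_norm_iteratedFDeriv_boostedKsPert_le_window Λ c m m₀ χ hm₀⟩

end Summit.FinalStateConjecture.FinalStateConjecture.Theorems
end
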